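import Summits.KontsevichZagierPeriods.KontsevichZagierPeriods.Theses.GenusOneIterated
import Summits.KontsevichZagierPeriods.KontsevichZagierPeriods.Theses.CoactionDevissage

/-!
# KontsevichZagierPeriods / GenusOneIterated — the frame assembly `Assembly` (stmt-KontsevichZagierPeriods-3175)

Item stmt-KontsevichZagierPeriods-3175 (`Assembly`, rank 1) is filed verbatim by two routes of the
sub-problem, `GenusOneIterated` and `CoactionDevissage` (the split-thesis frame of 2026-08-16):

  `TorsionFree → RationalKernel → KontsevichZagierPeriods`.

Informal content (Kontsevich–Zagier 2001, §1.2: Conjecture 1 in its kernel form with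
`ℚ`-coefficients, plus torsion-freeness of the formal period group, gives Conjecture 1 in its
two-representation form).  Unfold the summit `KontsevichZagierPeriods` to
`[r] − [r'] ∈ KZ.relations` for two rational-shape representations `r`, `r'` of equal value;
`KZ.eval ([r] − [r']) = r.value − r'.value = 0` (`KZ.eval_of`), so `RationalKernel` gives some
`n ≠ 0` with `n • ([r] − [r']) ∈ KZ.relations`, and `TorsionFree` divides by `n`.

Both antecedents are hypotheses of the implication and are NOT discharged here (`RationalKernel` is
the open, period-conjecture-strength frame target stmt-KontsevichZagierPeriods-3165; `TorsionFree`,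
stmt-KontsevichZagierPeriods-3169, is proved in `Theorems/CoactionDevissageTorsionFree.lean` but is
not needed as an import for an implication).  For route `CoactionDevissage` the statement is
literally the type of that route's kernel-checked deciding theorem `closes` (route file rev ≥ 4,
D-0027 §2.1), so the twin is settled by that term.

This module imports the two route modules `…Theses.GenusOneIterated` / `…Theses.CoactionDevissage`;
the gate records the closure as a docstring link in the route files.

References: M. Kontsevich, D. Zagier, *Periods* (2001), §1.2 (Conjecture 1 and its kernel form);
A. Huber, S. Müller-Stach, *Periods and Nori Motives* (2017), §13.1.
-/

namespace Summit.KontsevichZagierPeriods.GenusOneIterated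

open Literature.NumberTheory.Transcendental

/-- **Assembly of route GenusOneIterated** (settles stmt-KontsevichZagierPeriods-3175):
`TorsionFree → RationalKernel → KontsevichZagierPeriods`.  Given torsion-freeness of `P_KZ` and the
kernel form of Conjecture 1 with `ℚ`-coefficients, two rational-shape KZ representations `r`, `r'`
with `value r = value r'` are KZ-equivalent: `eval ([r] − [r']) = 0`, hence
`n • ([r] − [r']) ∈ KZ.relations` for some `n ≠ 0`, hence `[r] − [r'] ∈ KZ.relations`.
[Kontsevich–Zagier 2001, §1.2; Huber–Müller-Stach 2017, §13.1] [folklore] -/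
theorem assembly_proof :
    Summit.KontsevichZagierPeriods.KontsevichZagierPeriods.Theses.GenusOneIterated.Assembly := by
  unfold Summit.KontsevichZagierPeriods.KontsevichZagierPeriods.Theses.GenusOneIterated.Assembly
  intro hT hR n m r r' _ _ hv
  show KZ.of r - KZ.of r' ∈ KZ.relations
  obtain ⟨k, hk, hkc⟩ := hR (KZ.of r - KZ.of r') (by simp [KZ.eval_of, hv])
  exact hT k (KZ.of r - KZ.of r') hk hkc

/-- Route `CoactionDevissage`, verbatim twin of stmt-KontsevichZagierPeriods-3175:
`TorsionFree → RationalKernel → KontsevichZagierPeriods`, which is by definition the type of that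
route's deciding theorem `closes`. [Kontsevich–Zagier 2001, §1.2] [folklore] -/
theorem coactionDevissage_assembly_proof :
    Summit.KontsevichZagierPeriods.KontsevichZagierPeriods.Theses.CoactionDevissage.Assembly :=
  Summit.KontsevichZagierPeriods.KontsevichZagierPeriods.Theses.CoactionDevissage.closes

end Summit.KontsevichZagierPeriods.GenusOneIterated
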